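/-
Copyright (c) 2026 the pub-hodgecm-mathlib formalisation cell (harness21).  Prover seat hodgecm-mathlib-K2E1-p15 (g0), Track B ∕ K2-LIT «5Res», h413 = `stmt-HodgeConjecture-24833`,
line `K2_E1_TraceFormulaBeta`, route of record `HCCMUnconditional`; dealer K2E1-plan (g7) `hB` RULING 2026-09-04T13:03:44Z, DEFAULT (i): the CHANGE-OF-TRUNCATION brick (so that ONE
truncation level serves the whole strip in the Maass–Selberg bound `hB`).
-/
import Summits.HodgeConjecture.HodgeConjecture.Theorems.K2E1EisensteinSupNormBandBoundCMTwo    -- ★ p860289 (K2E1-p10): `exists_const_norm_eisensteinSeriesU_le_cm`, `eisensteinSeriesU_eq_finset_sum_of_band` (+ ★ `pseudoEisenstein_eq_eisensteinSeriesU'`)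
import Summits.HodgeConjecture.HodgeConjecture.Theorems.K2E1BLHeightPowerHolomorphicU2          -- ★ ℓ7 (K2E3-p12): `differentiableOn_of_weighted_bound`
import Summits.HodgeConjecture.HodgeConjecture.Theorems.K2E1TruncatedEisensteinL2               -- ★ (K2E1-p08): `measurable_quotFun_of_measurable`
import Literature.NumberTheory.Automorphic.UnitaryGroupTruncationFiniteSumTwo                     -- ★ `finite_support_constantTermTail_translate_two`, `finite_setOf_lt_borelHeight_two`
import Literature.NumberTheory.Automorphic.UnitaryGroupArthurTruncatedKernel                      -- ★ `pseudoEisenstein_rational_mul`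
import Literature.NumberTheory.Automorphic.UnitaryGroupKernelDictionary                           -- ★ `countable_quotientSubgroup_quasiSplit`, `quotientSubgroup_quasiSplit`
import HarnessLib

/-!
# K2·E1 — `K2E1TruncationLevelChangeU2`: CHANGE OF TRUNCATION LEVEL — `Λ^T φ − Λ^{T′} φ` IS THE PSEUDO-EISENSTEIN SERIES OF THE BAND `𝟙_{T′ < H ≤ T}·φ_B`, AND BAND
# PSEUDO-EISENSTEIN FAMILIES ARE HOLOMORPHIC INTO `L²(𝔛)` (`U(1,1)_{L∕L⁺}`)

Track B ∕ K2-LIT, crux h413 = `stmt-HodgeConjecture-24833`; cell `hodgecm-mathlib`, squad K2, ENGINE E1; dealer K2E1-plan (g7) `hB` ruling (13:03:44Z), DEFAULT (i).  THEOREMS ONLY (no `def`,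
no `instance`, no notation, no named-fact hypothesis, no `sorry`); lane `--kind proof --supports stmt-HodgeConjecture-24833 --as helper` (count-neutral).  Closes no socket.

WHY ([Arthur1980TraceFormulaII, §1]; [MoeglinWaldspurger1995, IV.2.3]).  The continued truncated families of ★ row 15 come PER BALL `D_n` at a ball-dependent level `T₀(n)`, while the
Maass–Selberg strip bound `hB` (`½ < Re ≤ σ₀`, `1 ≤ |Im|`) must be UNIFORM along the unbounded strip; the Maass–Selberg relation of ★ row 14 FILE 1 holds for EVERY `T ≥ 1`.  Moving
every ball's family to ONE common level needs only: (§1) the algebraic identity `Λ^T φ − Λ^{T′} φ = Ψ(𝟙_{T′ < H ≤ T}·φ_B)` (`Λ^T φ = φ − Ψ(𝟙_{H > T}·φ_B)`, ★ `truncation`), and (§2)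
the `L²(𝔛)`-holomorphy of BAND pseudo-Eisenstein families `z ↦ [Ψ(𝟙_{a < H ≤ b}·w_z)]` for a left-`B(F)`-invariant measurable `w_z`, pointwise holomorphic and bounded on the band:
the sum is a FINITE sum of at most `N₀` terms (★ `exists_ncard_setOf_lt_borelHeight_le_cm`), so the family is bounded and pointwise holomorphic, and ★ ℓ7 `differentiableOn_of_weighted_bound`
(weight `1`, finite `μ`) applies.  The sequel `K2E1TruncationLevelChangeFamilyCMTwo` feeds `w_z = f_z^φ + (ν𝓕)·f_{1−z}^{ψ(z)}` (★ row 2 constant term on the tube, the continued scattering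
vector `ψ(z)` of the ★ M1 print) and produces the row-15 family AT ANY LEVEL `T ≥ 1` with its `hFtube`.
* §1 (generic `(F, E, c)`, `U(J₂)`) **`truncation_sub_truncation_two`**.
* §2 (CM pair) `measurable_pseudoEisenstein_band`, `norm_pseudoEisenstein_band_le`, **`differentiableOn_family_quotFun_pseudoEisenstein_band`**.

HONEST LABEL: HC_CM is proved only modulo the 7 printed citations (2 remaining named inputs: hLiu418 = `stmt-HodgeConjecture-24832`, h413 = `stmt-HodgeConjecture-24833`) until rung 0
closes; this file asserts no named fact and closes no socket.

## References
* [Arthur1980TraceFormulaII] J. Arthur, *A trace formula for reductive groups II*, Compositio Math. 40 (1980), §1.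
* [MoeglinWaldspurger1995] C. Mœglin, J.-L. Waldspurger, *Spectral decomposition and Eisenstein series* (1995), I.2.13, IV.2.3.
* [Garrett2018] P. Garrett, *Modern Analysis of Automorphic Forms by Example* (2018), §2.10.
-/

set_option autoImplicit false
set_option linter.dupNamespace false  -- the mandated namespace repeats the summit's segment (`HodgeConjecture.HodgeConjecture`)

noncomputable section

open MeasureTheory Set Filter Topology NumberField
open scoped NNReal ENNReal
open Literature.NumberTheory.Automorphic Literature.NumberTheory.Automorphic.UnitaryGroup AdelicGroupData
open Summit.HodgeConjecture.HodgeConjecture.Cruxes.H413.K2E1BorelEisensteinU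
open Summit.HodgeConjecture.HodgeConjecture.Cruxes.H413.K2E1BorelCosetsDictionary (pseudoEisenstein_eq_eisensteinSeriesU')
open Summit.HodgeConjecture.HodgeConjecture.Cruxes.H413.K2E1EisensteinSupNormBandBoundCMTwo (exists_const_norm_eisensteinSeriesU_le_cm)
open Summit.HodgeConjecture.HodgeConjecture.Cruxes.H413.K2E1BLHeightPowerHolomorphicU2 (differentiableOn_of_weighted_bound)
open Summit.HodgeConjecture.HodgeConjecture.Cruxes.H413.K2E1TruncatedEisensteinL2 (measurable_quotFun_of_measurable)

namespace Summit.HodgeConjecture.HodgeConjecture.Cruxes.H413.K2E1TruncationLevelChangeU2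

/-! ## §1 `Λ^T φ − Λ^{T′} φ = Ψ(𝟙_{T′ < H ≤ T}·φ_B)` -/

section Algebra

variable {F E : Type} [Field F] [NumberField F] [Field E] [NumberField E] [Algebra F E] {c : E ≃ₐ[F] E}
  [MeasurableSpace (adelicUnipotent F E c 2)]

/-- **CHANGE OF TRUNCATION LEVEL** (`U(J₂)`, `0 < T′ ≤ T`): `Λ^T φ(g) − Λ^{T′} φ(g) = Ψ(𝟙_{T′ < H ≤ T}·φ_B)(g)` — the difference of two truncations is the pseudo-Eisenstein series of the
constant term restricted to the height band (both `δ`-sums are finite, ★ `finite_support_constantTermTail_translate_two`). [cite: Arthur1980TraceFormulaII, §1] [cite: Garrett2018, §2.10] -/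
theorem truncation_sub_truncation_two (ν : Measure (adelicUnipotent F E c 2)) (𝓕 : Set (adelicUnipotent F E c 2)) {T T' : ℝ≥0} (hT' : 0 < T') (hle : T' ≤ T)
    (φ : (quasiSplit F E c 2).Adelic → ℂ) (g : (quasiSplit F E c 2).Adelic) :
    truncation ν 𝓕 T φ g - truncation ν 𝓕 T' φ g =
      pseudoEisenstein ({x : (quasiSplit F E c 2).Adelic | T' < borelHeight x ∧ borelHeight x ≤ T}.indicator (borelConstantTerm ν 𝓕 φ)) g := by
  have hT : 0 < T := lt_of_lt_of_le hT' hle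
  rw [truncation_def, truncation_def, sub_sub_sub_cancel_left, pseudoEisenstein_def, pseudoEisenstein_def, pseudoEisenstein_def,
    ← finsum_sub_distrib (finite_support_constantTermTail_translate_two ν 𝓕 hT' φ g) (finite_support_constantTermTail_translate_two ν 𝓕 hT φ g)]
  refine finsum_congr fun q => ?_
  set y := (((q.out : (quasiSplit F E c 2).arithmeticSubgroup) : (quasiSplit F E c 2).Adelic) * g) with hy
  simp only [constantTermTail, Set.indicator_apply, Set.mem_setOf_eq]
  by_cases h1 : T' < borelHeight y
  · by_cases h2 : T < borelHeight y
    · rw [if_pos h1, if_pos h2, if_neg (fun h => not_le.2 h2 h.2), sub_self]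
    · rw [if_pos h1, if_neg h2, if_pos ⟨h1, not_lt.1 h2⟩, sub_zero]
  · have h2 : ¬ T < borelHeight y := fun h => h1 (lt_of_le_of_lt hle h)
    rw [if_neg h1, if_neg h2, if_neg (fun h => h1 h.1), sub_self]

end Algebra

/-! ## §2 Band pseudo-Eisenstein families are bounded, measurable, and holomorphic into `L²(𝔛)` -/

section Band

variable (L : Type) [Field L] [NumberField L] [IsCMField L]
  [MeasurableSpace (quasiSplit (↥(maximalRealSubfield L)) L (IsCMField.complexConj L) 2).Adelic] [BorelSpace (quasiSplit (↥(maximalRealSubfield L)) L (IsCMField.complexConj L) 2).Adelic]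

omit [MeasurableSpace (quasiSplit (↥(maximalRealSubfield L)) L (IsCMField.complexConj L) 2).Adelic] [BorelSpace (quasiSplit (↥(maximalRealSubfield L)) L (IsCMField.complexConj L) 2).Adelic] in
/-- A band function `𝟙_{a < H ≤ b}·w` with `w` left-`B(F)`-invariant is left-`B(F)`-invariant (★ `borelHeight_arithmeticBorel_mul`). [cite: Garrett2018, §2.2] -/
theorem band_indicator_arithmeticBorel_mul {a b : ℝ≥0} {w : (quasiSplit (↥(maximalRealSubfield L)) L (IsCMField.complexConj L) 2).Adelic → ℂ}
    (hwB : ∀ β ∈ arithmeticBorel (↥(maximalRealSubfield L)) L (IsCMField.complexConj L) 2, ∀ g, w ((β : (quasiSplit (↥(maximalRealSubfield L)) L (IsCMField.complexConj L) 2).Adelic) * g) = w g) :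
    ∀ β ∈ arithmeticBorel (↥(maximalRealSubfield L)) L (IsCMField.complexConj L) 2, ∀ g,
      {x : (quasiSplit (↥(maximalRealSubfield L)) L (IsCMField.complexConj L) 2).Adelic | a < borelHeight x ∧ borelHeight x ≤ b}.indicator w
          ((β : (quasiSplit (↥(maximalRealSubfield L)) L (IsCMField.complexConj L) 2).Adelic) * g) =
        {x : (quasiSplit (↥(maximalRealSubfield L)) L (IsCMField.complexConj L) 2).Adelic | a < borelHeight x ∧ borelHeight x ≤ b}.indicator w g := by
  intro β hβ g
  simp only [Set.indicator_apply, Set.mem_setOf_eq, K2E1TruncatedEisensteinExplicit.borelHeight_arithmeticBorel_mul hβ, hwB β hβ g]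

omit [MeasurableSpace (quasiSplit (↥(maximalRealSubfield L)) L (IsCMField.complexConj L) 2).Adelic] [BorelSpace (quasiSplit (↥(maximalRealSubfield L)) L (IsCMField.complexConj L) 2).Adelic] in
/-- The `δ`-sum of a band function is finite at every point (it vanishes unless `a < H`, ★ `finite_setOf_lt_borelHeight_two`). [cite: Garrett2018, §2.10] -/
theorem finite_support_band_translate {a b : ℝ≥0} (ha : 0 < a) (w : (quasiSplit (↥(maximalRealSubfield L)) L (IsCMField.complexConj L) 2).Adelic → ℂ)
    (g : (quasiSplit (↥(maximalRealSubfield L)) L (IsCMField.complexConj L) 2).Adelic) :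
    (Function.support fun q : Quotient (QuotientGroup.rightRel (arithmeticBorel (↥(maximalRealSubfield L)) L (IsCMField.complexConj L) 2)) =>
      {x : (quasiSplit (↥(maximalRealSubfield L)) L (IsCMField.complexConj L) 2).Adelic | a < borelHeight x ∧ borelHeight x ≤ b}.indicator w
        (((q.out : (quasiSplit (↥(maximalRealSubfield L)) L (IsCMField.complexConj L) 2).arithmeticSubgroup) : (quasiSplit (↥(maximalRealSubfield L)) L (IsCMField.complexConj L) 2).Adelic) * g)).Finite := by
  refine (finite_setOf_lt_borelHeight_two g ha).subset fun q hq => ?_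
  by_contra hlt
  exact hq (Set.indicator_of_notMem (fun h => hlt h.1) _)

omit [MeasurableSpace (quasiSplit (↥(maximalRealSubfield L)) L (IsCMField.complexConj L) 2).Adelic] [BorelSpace (quasiSplit (↥(maximalRealSubfield L)) L (IsCMField.complexConj L) 2).Adelic] in
/-- **UNIFORM BOUND OF A BAND PSEUDO-EISENSTEIN SERIES**: there is `C ≥ 0` (the uniform count ★ `exists_ncard_setOf_lt_borelHeight_le_cm` at `a`) such that for every left-`B(F)`-invariant `w`
with `‖w‖ ≤ M` on the band, `‖Ψ(𝟙_{a<H≤b}·w)(g)‖ ≤ C·max M 0` for all `g` (★ F3d-γ `exists_const_norm_eisensteinSeriesU_le_cm` ∘ ★ `pseudoEisenstein_eq_eisensteinSeriesU'`).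
[cite: MoeglinWaldspurger1995, II.1.3] [cite: Garrett2018, §2.10] -/
theorem exists_const_norm_pseudoEisenstein_band_le {a : ℝ≥0} (ha : 0 < a) :
    ∃ C : ℝ, 0 ≤ C ∧ ∀ (b : ℝ≥0) (w : (quasiSplit (↥(maximalRealSubfield L)) L (IsCMField.complexConj L) 2).Adelic → ℂ)
      (_ : ∀ β ∈ arithmeticBorel (↥(maximalRealSubfield L)) L (IsCMField.complexConj L) 2, ∀ g, w ((β : (quasiSplit (↥(maximalRealSubfield L)) L (IsCMField.complexConj L) 2).Adelic) * g) = w g)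
      (M : ℝ) (_ : ∀ g, a < borelHeight g → borelHeight g ≤ b → ‖w g‖ ≤ M) (g : (quasiSplit (↥(maximalRealSubfield L)) L (IsCMField.complexConj L) 2).Adelic),
        ‖pseudoEisenstein ({x : (quasiSplit (↥(maximalRealSubfield L)) L (IsCMField.complexConj L) 2).Adelic | a < borelHeight x ∧ borelHeight x ≤ b}.indicator w) g‖ ≤ C * max M 0 := by
  obtain ⟨C, hC0, hC⟩ := exists_const_norm_eisensteinSeriesU_le_cm L ha
  refine ⟨C, hC0, fun b w hwB M hM g => ?_⟩
  have hB := band_indicator_arithmeticBorel_mul L (a := a) (b := b) hwB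
  rw [pseudoEisenstein_eq_eisensteinSeriesU' hB g (finite_support_band_translate L ha w g)]
  refine hC _ hB (fun x hx => Set.indicator_of_notMem (fun h => not_le.2 h.1 hx) _) (max M 0) (fun x => ?_) g
  by_cases hx : x ∈ {x : (quasiSplit (↥(maximalRealSubfield L)) L (IsCMField.complexConj L) 2).Adelic | a < borelHeight x ∧ borelHeight x ≤ b}
  · rw [Set.indicator_of_mem hx]
    exact (hM x hx.1 hx.2).trans (le_max_left _ _)
  · rw [Set.indicator_of_notMem hx, norm_zero]
    exact le_max_right _ _

/-- **A BAND PSEUDO-EISENSTEIN SERIES IS MEASURABLE** for measurable left-`B(F)`-invariant `w` (countably many measurable translates: the `δ`-sum is finite at each point, so it is the `tsum`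
over the countable `B(F)∖G(F)`, Mathlib `Measurable.tsum`). [cite: MoeglinWaldspurger1995, I.2.13] -/
theorem measurable_pseudoEisenstein_band {a b : ℝ≥0} (ha : 0 < a) {w : (quasiSplit (↥(maximalRealSubfield L)) L (IsCMField.complexConj L) 2).Adelic → ℂ} (hwm : Measurable w) :
    Measurable (pseudoEisenstein ({x : (quasiSplit (↥(maximalRealSubfield L)) L (IsCMField.complexConj L) 2).Adelic | a < borelHeight x ∧ borelHeight x ≤ b}.indicator w)) := by
  haveI : Countable (quasiSplit (↥(maximalRealSubfield L)) L (IsCMField.complexConj L) 2).arithmeticSubgroup := by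
    rw [← quotientSubgroup_quasiSplit]; exact countable_quotientSubgroup_quasiSplit
  haveI : Countable (Quotient (QuotientGroup.rightRel (arithmeticBorel (↥(maximalRealSubfield L)) L (IsCMField.complexConj L) 2))) := Quotient.countable
  have hband : MeasurableSet {x : (quasiSplit (↥(maximalRealSubfield L)) L (IsCMField.complexConj L) 2).Adelic | a < borelHeight x ∧ borelHeight x ≤ b} :=
    (isOpen_lt continuous_const continuous_borelHeight).measurableSet.inter (isClosed_le continuous_borelHeight continuous_const).measurableSet
  have hum : Measurable ({x : (quasiSplit (↥(maximalRealSubfield L)) L (IsCMField.complexConj L) 2).Adelic | a < borelHeight x ∧ borelHeight x ≤ b}.indicator w) := hwm.indicator hband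
  have heq : pseudoEisenstein ({x : (quasiSplit (↥(maximalRealSubfield L)) L (IsCMField.complexConj L) 2).Adelic | a < borelHeight x ∧ borelHeight x ≤ b}.indicator w) =
      fun g => ∑' q : Quotient (QuotientGroup.rightRel (arithmeticBorel (↥(maximalRealSubfield L)) L (IsCMField.complexConj L) 2)),
        {x : (quasiSplit (↥(maximalRealSubfield L)) L (IsCMField.complexConj L) 2).Adelic | a < borelHeight x ∧ borelHeight x ≤ b}.indicator w
          (((q.out : (quasiSplit (↥(maximalRealSubfield L)) L (IsCMField.complexConj L) 2).arithmeticSubgroup) : (quasiSplit (↥(maximalRealSubfield L)) L (IsCMField.complexConj L) 2).Adelic) * g) := by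
    funext g
    rw [pseudoEisenstein_def]
    exact (tsum_eq_finsum (finite_support_band_translate L ha w g)).symm
  rw [heq]
  exact Measurable.tsum fun q => hum.comp (measurable_const_mul _)

/-- **BAND PSEUDO-EISENSTEIN FAMILIES ARE HOLOMORPHIC INTO `L²(𝔛)`.**  Data: a finite measure `μ` on `𝔛`, an open `D ⊆ ℂ`, a band `a < H ≤ b` (`a > 0`), a family `w : ℂ → G → ℂ` with
`w z` left-`B(F)`-invariant and measurable, `z ↦ w z g` holomorphic on `D` for `g` in the band, `‖w z g‖ ≤ M` on `D × band`; and `F : ℂ → L²(μ)` with `F z =ᵐ quotFun (Ψ(𝟙_{band}·w z))`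
for `z ∈ D`.  THEN `F` is holomorphic on `D`: at each `x ∈ 𝔛` the sum is a FINITE sum over a `z`-independent index set (★ `finite_setOf_lt_borelHeight_two`) of functions holomorphic in
`z`, uniformly bounded by `C·max M 0`, Borel in `x` (§2 + ★ `measurable_quotFun_of_measurable` with ★ `pseudoEisenstein_rational_mul`) — ★ ℓ7 `differentiableOn_of_weighted_bound` with
weight `1`. [cite: MoeglinWaldspurger1995, I.2.13, IV.2.3] [cite: BernsteinLapid2019, Thm 2.3] -/
theorem differentiableOn_family_quotFun_pseudoEisenstein_band
    (μ : Measure (quasiSplit (↥(maximalRealSubfield L)) L (IsCMField.complexConj L) 2).automorphicQuotient) [IsFiniteMeasure μ]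
    {D : Set ℂ} (hD : IsOpen D) {a b : ℝ≥0} (ha : 0 < a) (w : ℂ → (quasiSplit (↥(maximalRealSubfield L)) L (IsCMField.complexConj L) 2).Adelic → ℂ)
    (hwB : ∀ z ∈ D, ∀ β ∈ arithmeticBorel (↥(maximalRealSubfield L)) L (IsCMField.complexConj L) 2, ∀ g, w z ((β : (quasiSplit (↥(maximalRealSubfield L)) L (IsCMField.complexConj L) 2).Adelic) * g) = w z g)
    (hwm : ∀ z ∈ D, Measurable (w z))
    (hwd : ∀ g, a < borelHeight g → borelHeight g ≤ b → DifferentiableOn ℂ (fun z => w z g) D)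
    {M : ℝ} (hM : ∀ z ∈ D, ∀ g, a < borelHeight g → borelHeight g ≤ b → ‖w z g‖ ≤ M)
    (F : ℂ → Lp ℂ 2 μ)
    (hF : ∀ z ∈ D, ((F z : Lp ℂ 2 μ) : (quasiSplit (↥(maximalRealSubfield L)) L (IsCMField.complexConj L) 2).automorphicQuotient → ℂ) =ᵐ[μ]
      (quasiSplit (↥(maximalRealSubfield L)) L (IsCMField.complexConj L) 2).quotFun
        (pseudoEisenstein ({x : (quasiSplit (↥(maximalRealSubfield L)) L (IsCMField.complexConj L) 2).Adelic | a < borelHeight x ∧ borelHeight x ≤ b}.indicator (w z)))) :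
    DifferentiableOn ℂ F D := by
  classical
  obtain ⟨C, hC0, hC⟩ := exists_const_norm_pseudoEisenstein_band_le L ha
  refine differentiableOn_of_weighted_bound (μ := μ) (W := fun _ => (1 : ℝ)) (C := C * max M 0)
    (f := fun z => (quasiSplit (↥(maximalRealSubfield L)) L (IsCMField.complexConj L) 2).quotFun
      (pseudoEisenstein ({x : (quasiSplit (↥(maximalRealSubfield L)) L (IsCMField.complexConj L) 2).Adelic | a < borelHeight x ∧ borelHeight x ≤ b}.indicator (w z))))
    hD (fun x => ?_) (fun z hz => ?_) (memLp_const 1) (by positivity) (fun z hz x => ?_) hF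
  · -- pointwise holomorphy: a finite sum over a `z`-independent index set
    set g₀ : (quasiSplit (↥(maximalRealSubfield L)) L (IsCMField.complexConj L) 2).Adelic :=
      (Quotient.out (x : (quasiSplit (↥(maximalRealSubfield L)) L (IsCMField.complexConj L) 2).Adelic ⧸ (quasiSplit (↥(maximalRealSubfield L)) L (IsCMField.complexConj L) 2).quotientSubgroup))⁻¹ with hg₀
    set S := (finite_setOf_lt_borelHeight_two g₀ ha).toFinset with hS
    have heq : (fun z => (quasiSplit (↥(maximalRealSubfield L)) L (IsCMField.complexConj L) 2).quotFun
        (pseudoEisenstein ({x : (quasiSplit (↥(maximalRealSubfield L)) L (IsCMField.complexConj L) 2).Adelic | a < borelHeight x ∧ borelHeight x ≤ b}.indicator (w z))) x) =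
        fun z => ∑ q ∈ S, {x : (quasiSplit (↥(maximalRealSubfield L)) L (IsCMField.complexConj L) 2).Adelic | a < borelHeight x ∧ borelHeight x ≤ b}.indicator (w z)
          (((q.out : (quasiSplit (↥(maximalRealSubfield L)) L (IsCMField.complexConj L) 2).arithmeticSubgroup) : (quasiSplit (↥(maximalRealSubfield L)) L (IsCMField.complexConj L) 2).Adelic) * g₀) := by
      funext z
      show pseudoEisenstein _ g₀ = _
      rw [pseudoEisenstein_def]
      refine finsum_eq_sum_of_support_subset _ fun q hq => ?_
      rw [hS, Set.Finite.coe_toFinset]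
      by_contra hlt
      exact hq (Set.indicator_of_notMem (fun h => hlt h.1) _)
    rw [heq]
    refine DifferentiableOn.fun_sum fun q _ => ?_
    by_cases hq : (((q.out : (quasiSplit (↥(maximalRealSubfield L)) L (IsCMField.complexConj L) 2).arithmeticSubgroup) : (quasiSplit (↥(maximalRealSubfield L)) L (IsCMField.complexConj L) 2).Adelic) * g₀) ∈
        {x : (quasiSplit (↥(maximalRealSubfield L)) L (IsCMField.complexConj L) 2).Adelic | a < borelHeight x ∧ borelHeight x ≤ b}
    · simp only [Set.indicator_of_mem hq]
      exact hwd _ hq.1 hq.2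
    · simp only [Set.indicator_of_notMem hq]
      exact differentiableOn_const 0
  · -- measurability of the descent
    refine (measurable_quotFun_of_measurable (measurable_pseudoEisenstein_band L ha (hwm z hz)) fun γ y => ?_).aestronglyMeasurable
    exact pseudoEisenstein_rational_mul (band_indicator_arithmeticBorel_mul L (hwB z hz)) γ y
  · -- the uniform bound
    rw [mul_one]
    exact AdelicGroupData.norm_quotFun_le (fun g => hC b (w z) (hwB z hz) M (hM z hz) g) x

end Band

end Summit.HodgeConjecture.HodgeConjecture.Cruxes.H413.K2E1TruncationLevelChangeU2

end
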